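import Summits.BirchSwinnertonDyer.BirchSwinnertonDyer.Theses.ThetaPartnerAtTwo
import Summits.BirchSwinnertonDyer.BirchSwinnertonDyer.Theorems.ThetaPartnerAtTwoSignedMainConjectureCMTwoRankZeroKato
import Summits.BirchSwinnertonDyer.BirchSwinnertonDyer.Theorems.ThetaPartnerAtTwoSignedMainConjectureCMTwoPeriodUnit
import HarnessLib

/-!
# Route `ThetaPartnerAtTwo` (TP2), crux K2r0 `SignedMainConjectureCMTwoRankZero` (item stmt-BirchSwinnertonDyer-20312),
# consumed by crux `SupersingularRankZeroAtTwo` (item stmt-BirchSwinnertonDyer-19097) on the theta habitat: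
# **the Eisenstein half of the CM partner is NOT load-bearing** — K2r0 at a rank-`0` CM partner `A` from its
# KATO half UP TO A POWER OF `2` (crux K3's shape, read at `A`) + `μ⁺(A) = 0` + Kim's control term at `2` +
# Burungale–Flach + the `p = 2` period fact (seat `bsd-2adic-ss-1x` GEN 3, WIDTH-LEVER second lane on 19097)

HONEST FRAMING (cells `bsd-2adic` run/shared/lean/pub/bsd-2adic/ and `bsd-wall` …/bsd-wall/; HUMAN RULINGS
D-0036/D-0054/D-0074): THEOREMS ONLY — no definition, no named fact, no instance, no `sorry`; nothing about any
Selmer group, zeta element or `L`-value is asserted beyond the displayed binders; closes no item; BSD is NOT proved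
by any of this. PARTITION (D-0054): X5@2 good-supersingular, `a₂ = 0` THETA-HABITAT sub-row (19/208 rank-`0`
census classes) × `p = 2` — types-the-object-of (the CM partner's input K2r0); bears_on: TP2 K2r0 (20312) ·
K4-leaf crux 19097 (via `ThetaPartnerXRoute.thetaHabitat_of_signedTransport_of_stubs`, p528677).

WHY. The registered line `rankzero` of K2r0 (seat `bsd-wall-tp2-p2`) carries the LOAD-BEARING stub (E_A)
`KobayashiLowerDivisibility A 2 1` — the elliptic-unit / Eisenstein half of Kobayashi's `+` main conjecture for
the CM partner at the INERT prime `2` (Pollack–Rubin 2004 §§4–7 read at `p = 2`); tp2-p2 g3 (2026-08-27T14:59Z)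
recorded a genuine `p = 2` obstruction there (`tors Gal(K(A[2^∞])/K) ≅ μ₆ ∋ −1`, PR04 §§6–7 acquire
`Ĥ^*({±1}, X_∞)`-terms) and the verdict «open-problem». The companion file `…RankZeroKato.lean` (tp2-p2 g1) has
the KATO direction, but only for the EXACT Kato half (`m = 0`, `ι(g·h) = ϖ·ι L♭`), which nothing supplies: what
Kato's zeta elements give through the `+` Coleman map is crux K3's shape `ι(g·h) = 2^m·ϖ·ι L♭` (Kobayashi
Thm. 4.1 first display «`pⁿ L_p(E, α, X) ∈ Char X`»; `m` = the uncontrolled `(2)`-primary part at the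
height-one prime `𝔭 ∋ 2` off Kato's Thm. 12.5 (4)), and at the CM partner this shape IS available in the same
currency as at `E`: Kato §15 proves Thm. 12.4 and Thm. 12.5 (1)–(3) for CM newforms (Astérisque 295 p. 250,
15.18: "we can prove Thm. 14.5 (1)(2) for f by using Thm. 12.5 (3) in the same way"), with no parity
hypothesis, so `ThetaPartnerXRoute.exists_charGenerator_mul_eq_C_pow_mul_of_colemanSkeletonRat` (H3, p527438,
any curve) applies to `A`. This file proves that the `2^m`-shape SUFFICES once `μ⁺(A) = 0` — K2r0's OWN first
conjunct — is granted:

* §1 `exists_mul_eq_of_mul_eq_C_pow_mul_of_not_C_dvd` (Λ-algebra, any `p`): if `ι(g·h) = p^m·ϖ·ι L` with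
  `ϖ ∈ ℚ` `p`-integral and `p ∤ g` in `Λ = ℤ_p⟦T⟧`, then `ι(g·h′) = ϖ·ι L` for some `h′ ∈ Λ` (`p` is a prime
  element of `Λ`, `IwasawaAlgebra.prime_C`, so `p^m ∣ h`).
* §2 `kobayashiMainConjecture_two_one_conclusion_of_upperDivisibilityUpTo_of_mu_eq_zero` — at a curve with
  `L(W,1) ≠ 0`, BSD₂(W), GZK and Kim's control term at `2`: the `2^m`-Kato half + `μ(X⁺) = 0` give the
  conclusion of `KobayashiMainConjecture W 2 1` at the datum (reduction to tp2-p2's `m = 0` theorem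
  `kobayashiMainConjecture_two_one_conclusion_of_upperDivisibility` by §1; `μ = 0 ⟺ 2 ∤ g` is the tree theorem
  `muInvariant_eq_zero_iff_not_C_dvd_of_charIdeal_eq_span`).
* §3 `signedMainConjectureCMTwoRankZero_of_katoUpTo_of_mu` — **K2r0 VERBATIM** (the route decl
  `Theses.ThetaPartnerAtTwo.SignedMainConjectureCMTwoRankZero`) from, for every rank-`0` CM partner: (T2_A)
  torsion · (μ_A) `μ⁺(A) = 0` · (K4c_A) Kim's control term at `2` · (K3_A) the Kato half up to `2^m` — plus
  PUB by name (Burungale–Flach `hBF`, entire `L` `hLrat` (modularity), GZK, the `p = 2` period fact `h2` =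
  `realPeriodRat_eq_unit_mul_plusPeriod_two`, Abbes–Ullmo/Greenberg–Vatsal). NO `KobayashiLowerDivisibility`,
  no analytic `μ(L♭_A) = 0`, no signed generator change.
* Companion file `ByReductionTypeAtTwoSupersingularThetaHabitatKatoBothSides.lean`: crux 19097 ON THE THETA
  HABITAT with NO EISENSTEIN-SIDE INPUT ON EITHER CURVE ((K3_A) supplied from Kato PUB + the rational
  Coleman–Kato package READ AT `A`; stub (3) for `E` and (E_A) for `A` both absent — Burungale–Flach's BSD₂(A),
  a THEOREM at `p = 2`, plays the Eisenstein role for the pair).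

What this buys / does not buy (numbers, not adjectives): on the 19 habitat classes of HABITAT-CENSUS-TP2-v1 the
research content of the CM side becomes {(T2_A), (K4c_A), (K3_A), μ⁺(A) = 0} — the SAME species as `E`'s stubs
(2′)/(1′)+(4) (Kobayashi Thm. 1.2 / Kim Cor. 3.15 / Kato 12.4–12.5 (3) + Coleman at `2`, each «same method as
p > 2» per Kurihara–Otsuki p. 557) plus one `μ`-clause — instead of Pollack–Rubin at the inert prime `2`. It does
NOT remove K1 (transport) nor `μ⁺(A) = 0`; on the habitat `μ⁺(A) = 0 ⟺ μ⁺(E) = 0` along `E[2] ≅ A[2]`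
(B. D. Kim 2009 Cor. 2.13 shape; tp2-p1's residual-Selmer stub `stub_sel2`, either direction), so the `μ`-clause
may equally be read on `E` (stub (4′) species / Kato 12.5 (4) at `2` for the 17 two-adically surjective classes).

References: [Kobayashi2003] S. Kobayashi, Invent. Math. 152 (2003), Thm. 1.2, Thm. 1.3, Thm. 4.1 (p. 8), Conjecture
(p. 2); [Kato2004Asterisque] K. Kato, Astérisque 295 (2004), Thm. 12.4, Thm. 12.5 (3) (pp. 221–222), §15 (p. 250,
15.18); [BDKim2013] Cor. 3.15; [BurungaleFlach2024] Thm. 1.1 / Cor. 2; [PollackRubin2004] Thm. 7.3 (p > 2);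
[KuriharaOtsuki2006] pp. 557, 564; [AbbesUllmo1996] Thm. A; [GreenbergVatsal2000] §3 Rem. 3.4, Thm. (1.4);
[Washington1997] §7.1, §13.2; [Miller2011LMS] Def. 1.1.
-/

set_option autoImplicit false
-- the Theorems namespace of this sub repeats the summit name by design (D-0017 nested layout)
set_option linter.dupNamespace false

noncomputable section

open scoped Classical MatrixGroups ModularForm

open CongruenceSubgroup WeierstrassCurve Literature.NumberTheory.EllipticCurves
  Literature.NumberTheory.EllipticCurves.ModularForms Literature.NumberTheory.EllipticCurves.Sprung2017
  Literature.NumberTheory.EllipticCurves.Rank1Residual Literature.NumberTheory.EllipticCurves.Rank1Residual.Typed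
  Literature.NumberTheory.EllipticCurves.Kobayashi2003 Literature.NumberTheory.EllipticCurves.IwasawaDual
  ZpExtension Summit.BirchSwinnertonDyer.Rank1Residual Summit.BirchSwinnertonDyer.Rank1Residual.Supersingular
  Summit.BirchSwinnertonDyer.Rank1Residual.X5.O1 Summit.BirchSwinnertonDyer.BirchSwinnertonDyer.Theses.ThetaPartnerAtTwo

namespace Summit.BirchSwinnertonDyer.BirchSwinnertonDyer.Theorems

namespace ThetaPartnerXRoute

/-! ## §1 `Λ`-algebra: a `p^m`-divisibility with `p ∤ g` is an exact divisibility -/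

section Algebra

variable {p : ℕ} [Fact p.Prime]

/-- A rational number of `p`-adic valuation `0` has `p`-adic norm `≤ 1` (norm `1` if non-zero, `0` if zero).
[folklore] -/
theorem norm_ratCast_le_one_of_padicValRat_eq_zero {ϖ : ℚ} (hϖ : padicValRat p ϖ = 0) :
    ‖(ϖ : ℚ_[p])‖ ≤ 1 := by
  by_cases hϖ0 : ϖ = 0
  · rw [hϖ0, Rat.cast_zero, norm_zero]
    exact zero_le_one
  · have hϖQ : (ϖ : ℚ_[p]) ≠ 0 := by exact_mod_cast hϖ0
    rw [Padic.norm_eq_zpow_neg_valuation hϖQ, Padic.valuation_ratCast, hϖ, neg_zero, zpow_zero]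

/-- **`p^m` divides `x` in `Λ` when `ι x = p^m · ϖ · ι L` with `ϖ` `p`-integral**: every coefficient of `x`
has norm `≤ p^{-m}` (`‖ϖ‖ ≤ 1`, `‖L_n‖ ≤ 1`), i.e. lies in `p^m ℤ_p` (`PadicInt.norm_le_pow_iff_mem_span_pow`),
and `C a ∣ x` iff `a` divides every coefficient. [folklore] [cite: Washington1997, §7.1] -/
theorem C_pow_dvd_of_map_eq_C_pow_mul {x L : IwasawaAlgebra p} {ϖ : ℚ} {m : ℕ}
    (hϖ : ‖(ϖ : ℚ_[p])‖ ≤ 1)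
    (hx : iwasawaToPowerSeries p x =
      PowerSeries.C ((p : ℚ_[p]) ^ m * (ϖ : ℚ_[p])) * iwasawaToPowerSeries p L) :
    PowerSeries.C (p : ℤ_[p]) ^ m ∣ x := by
  rw [← map_pow, PowerSeries.C_dvd_iff_forall_dvd_coeff]
  intro n
  have hc := congrArg (PowerSeries.coeff n) hx
  rw [PowerSeries.coeff_map, PowerSeries.coeff_C_mul, PowerSeries.coeff_map] at hc
  -- `‖x_n‖ = ‖p^m‖ · ‖ϖ‖ · ‖L_n‖ ≤ p^{-m}`
  have hnorm : ‖PowerSeries.coeff n x‖ ≤ (p : ℝ) ^ (-(m : ℤ)) := by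
    rw [PadicInt.norm_def]
    change ‖(algebraMap ℤ_[p] ℚ_[p]) (PowerSeries.coeff n x)‖ ≤ _
    rw [hc, norm_mul, norm_mul, Padic.norm_p_pow]
    have hL : ‖(algebraMap ℤ_[p] ℚ_[p]) (PowerSeries.coeff n L)‖ ≤ 1 := PadicInt.norm_le_one _
    have hpm : 0 ≤ (p : ℝ) ^ (-(m : ℤ)) := zpow_nonneg (Nat.cast_nonneg _) _
    calc (p : ℝ) ^ (-(m : ℤ)) * ‖(ϖ : ℚ_[p])‖ * ‖(algebraMap ℤ_[p] ℚ_[p]) (PowerSeries.coeff n L)‖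
        ≤ (p : ℝ) ^ (-(m : ℤ)) * 1 * 1 := by gcongr
      _ = (p : ℝ) ^ (-(m : ℤ)) := by ring
  have hmem := (PadicInt.norm_le_pow_iff_mem_span_pow _ m).mp hnorm
  exact Ideal.mem_span_singleton.mp hmem

/-- **A `p^m`-divisibility with `p ∤ g` is an exact divisibility.** In `Λ = ℤ_p⟦T⟧`: if
`ι(g·h) = p^m · ϖ · ι L` with `ϖ ∈ ℚ` `p`-integral and `p ∤ g` (i.e. `μ(g) = 0`), then `p^m ∣ h` (`p` is a
prime element of `Λ`, `IwasawaAlgebra.prime_C`), and `h = p^m·h′` gives `ι(g·h′) = ϖ · ι L`.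
[cite: Washington1997, §7.1 and §13.2] [cite: GreenbergVatsal2000, p. 2, (1)–(2)] -/
theorem exists_mul_eq_of_mul_eq_C_pow_mul_of_not_C_dvd {g h L : IwasawaAlgebra p} {ϖ : ℚ} {m : ℕ}
    (hϖ : ‖(ϖ : ℚ_[p])‖ ≤ 1)
    (hgh : iwasawaToPowerSeries p (g * h) =
      PowerSeries.C ((p : ℚ_[p]) ^ m * (ϖ : ℚ_[p])) * iwasawaToPowerSeries p L)
    (hg : ¬ PowerSeries.C (p : ℤ_[p]) ∣ g) :
    ∃ h' : IwasawaAlgebra p,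
      iwasawaToPowerSeries p (g * h') = PowerSeries.C (ϖ : ℚ_[p]) * iwasawaToPowerSeries p L := by
  have hdvd : PowerSeries.C (p : ℤ_[p]) ^ m ∣ g * h := C_pow_dvd_of_map_eq_C_pow_mul hϖ hgh
  obtain ⟨h', rfl⟩ := (IwasawaAlgebra.prime_C p).pow_dvd_of_dvd_mul_left m hg hdvd
  refine ⟨h', ?_⟩
  have hCp : iwasawaToPowerSeries p (PowerSeries.C (p : ℤ_[p]) ^ m) = PowerSeries.C ((p : ℚ_[p]) ^ m) := by
    rw [map_pow, PowerSeries.map_C, map_natCast, map_pow]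
  have hne : PowerSeries.C ((p : ℚ_[p]) ^ m) ≠ 0 := by
    intro h0
    have h1 := congrArg PowerSeries.constantCoeff h0
    rw [PowerSeries.constantCoeff_C, map_zero] at h1
    exact pow_ne_zero _ (Nat.cast_ne_zero.mpr (Fact.out : p.Prime).ne_zero) h1
  apply mul_left_cancel₀ hne
  calc PowerSeries.C ((p : ℚ_[p]) ^ m) * iwasawaToPowerSeries p (g * h')
      = iwasawaToPowerSeries p (g * (PowerSeries.C (p : ℤ_[p]) ^ m * h')) := by
        rw [map_mul, map_mul, map_mul, hCp]; ring
    _ = PowerSeries.C ((p : ℚ_[p]) ^ m * (ϖ : ℚ_[p])) * iwasawaToPowerSeries p L := hgh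
    _ = PowerSeries.C ((p : ℚ_[p]) ^ m) * (PowerSeries.C (ϖ : ℚ_[p]) * iwasawaToPowerSeries p L) := by
        rw [map_mul, mul_assoc]

end Algebra

/-! ## §2 At a curve with `L(W,1) ≠ 0`: BSD₂ + Kim's term + the `2^m`-Kato half + `μ⁺ = 0` ⇒ the conclusion of
the `+` main conjecture at `2` -/

section OneDatum

variable (A : WeierstrassCurve ℚ) [A.IsElliptic] [A.IsGloballyMinimal]

/-- **The conclusion of the `+` main conjecture at `2` from the Kato half UP TO `2^m` and `μ⁺ = 0`, at a curve
with `L(W,1) ≠ 0` and BSD₂ known.** Same setting as tp2-p2's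
`kobayashiMainConjecture_two_one_conclusion_of_upperDivisibility` (`m = 0`), with the divisibility weakened to
crux K3's shape `ι(g·h) = 2^m·ϖ·ι L♭` and the extra inputs `D.mu = 0` and `ord₂ ϖ = 0`: `μ = 0` means `2 ∤ g`
(`muInvariant_eq_zero_iff_not_C_dvd_of_charIdeal_eq_span`), so `2^m ∣ h` (§1) and the `m = 0` theorem applies.
[cite: Kobayashi2003, Thm. 4.1 (p. 8) and Conjecture (p. 2)] [cite: BDKim2013, Cor. 3.15 (p odd in print)]
[cite: Washington1997, §13.2] -/
theorem kobayashiMainConjecture_two_one_conclusion_of_upperDivisibilityUpTo_of_mu_eq_zero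
    (hGZK : rank_eq_analyticRank_of_analyticRank_le_one)
    (hss : GoodSS A 2) (ha : A.frobeniusTrace 2 = 0) (hL : A.entireLFunction 1 ≠ 0)
    (hBSD : BSDp A 2)
    (hKim : ∀ (κ : ZpExtension ℚ 2) (γ : Field.absoluteGaloisGroup ℚ),
      κ.IsCyclotomic → κ.IsTopGenerator γ →
      ∀ (D : SignedSelmerDualData A κ γ 1) [Module.Finite (IwasawaAlgebra 2) D.X],
        Module.IsTorsion (IwasawaAlgebra 2) D.X →
      ∀ g : IwasawaAlgebra 2, D.charIdeal = Ideal.span {g} → Finite (A.selmerGroupPInfty 2) →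
        ∃ u : ℤ_[2]ˣ, ((PowerSeries.constantCoeff g : ℤ_[2]) : ℚ_[2]) =
          ((u : ℤ_[2]) : ℚ_[2]) * ((2 : ℕ) : ℚ_[2]) ^ (padicValNat 2 A.tamagawaProduct) *
            (Nat.card (A.selmerGroupPInfty 2) : ℚ_[2]))
    {κ : ZpExtension ℚ 2} {γ : Field.absoluteGaloisGroup ℚ} (hκ : κ.IsCyclotomic)
    (hγ : κ.IsTopGenerator γ) (D : SignedSelmerDualData A κ γ 1)
    [Module.Finite (IwasawaAlgebra 2) D.X] (hTors : Module.IsTorsion (IwasawaAlgebra 2) D.X)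
    (hμ : D.mu = 0)
    [NeZero (A.conductorNorm ℤ)] {f : CuspForm (Gamma0 (A.conductorNorm ℤ)) 2} (hf : IsNewformOf A f)
    {ϖ : ℚ} (hϖ : (ϖ : ℝ) * A.realPeriodRat = plusPeriod f) (hϖv : padicValRat 2 ϖ = 0)
    {Lplus Lminus : IwasawaAlgebra 2} (hPP : IsPollackPair f 2 Lplus Lminus)
    {g h : IwasawaAlgebra 2} {m : ℕ} (hchar : D.charIdeal = Ideal.span {g})
    (hdiv : iwasawaToPowerSeries 2 (g * h) =
      PowerSeries.C ((2 : ℚ_[2]) ^ m * (ϖ : ℚ_[2])) * iwasawaToPowerSeries 2 (kobayashiL 1 Lplus Lminus)) :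
    ∃ g' : IwasawaAlgebra 2, D.charIdeal = Ideal.span {g'} ∧
      iwasawaToPowerSeries 2 g' =
        PowerSeries.C (ϖ : ℚ_[2]) * iwasawaToPowerSeries 2 (kobayashiL 1 Lplus Lminus) := by
  -- `μ⁺ = 0` ⟹ `2 ∤ g`
  have hg : ¬ PowerSeries.C ((2 : ℕ) : ℤ_[2]) ∣ g :=
    (muInvariant_eq_zero_iff_not_C_dvd_of_charIdeal_eq_span D.X hTors hchar).mp hμ
  have hdiv' : iwasawaToPowerSeries 2 (g * h) =
      PowerSeries.C ((((2 : ℕ) : ℕ) : ℚ_[2]) ^ m * (ϖ : ℚ_[2])) *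
        iwasawaToPowerSeries 2 (kobayashiL 1 Lplus Lminus) := by
    rw [hdiv]; norm_num
  obtain ⟨h', hh'⟩ := exists_mul_eq_of_mul_eq_C_pow_mul_of_not_C_dvd
    (norm_ratCast_le_one_of_padicValRat_eq_zero hϖv) hdiv' hg
  exact kobayashiMainConjecture_two_one_conclusion_of_upperDivisibility A hGZK hss ha hL hBSD hKim hκ hγ D
    hTors hf hϖ hPP hchar hh'

end OneDatum

/-! ## §3 K2r0 VERBATIM from the `2^m`-Kato half + `μ⁺ = 0` + torsion + Kim's term at the rank-`0` CM partners -/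

/-- **K2r0 `SignedMainConjectureCMTwoRankZero` (item 20312) — the route decl VERBATIM — with NO Eisenstein-side
input.** Class-wide binders, each ∀ over CM `A/ℚ` (globally minimal) of ANALYTIC RANK `0`, good supersingular at
`2`, `a₂ = 0`: (T2_A) `hT2` torsion of every signed dual datum (Kobayashi Thm. 1.2 torsion half at `2` =
bottom-layer signed control, tp2-p2 `torsionCMTwo_of_finite_invariants_normalised`); (μ_A) `hmu` `μ⁺(A) = 0`
at every cyclotomic top-generator pair (K2r0's own first conjunct; on the habitat ⟺ `μ⁺(E) = 0` along
`E[2] ≅ A[2]`); (K4c_A) `hKim` B. D. Kim's control term at `2` (crux K4c conjunct 2 read for `A`); (K3_A) `hup`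
the Kato half UP TO `2^m` — crux K3 `SignedKatoDivisibilityUpToAtTwo`'s body read for `A` (supplied by Kato
Thm. 12.4 + 12.5 (3) for the CM newform, §15, and the RATIONAL Coleman–Kato package at `A`, via H3
`exists_charGenerator_mul_eq_C_pow_mul_of_colemanSkeletonRat`). PUB by name: `hBF` Burungale–Flach (BSD for
CM rank-`0` curves at every prime), `hLrat` (entire `L`, from modularity), `hGZK`, `h2` the `p = 2` period fact
(Abbes–Ullmo / Greenberg–Vatsal Rem. 3.4: `ord₂ ϖ = 0`, tp2-p2 `padicValRat_periodRatio_eq_zero_two`).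
Absent: `KobayashiLowerDivisibility A 2 1`, the analytic `μ(L♭_A) = 0`, signed generator change.
[cite: BurungaleFlach2024, Thm. 1.1 and Cor. 2] [cite: Kobayashi2003, Thm. 1.2, Thm. 4.1 and Conjecture (p. 2)]
[cite: Kato2004Asterisque, Thm. 12.4–12.5 (3) and §15 (15.18)] [cite: BDKim2013, Cor. 3.15]
[cite: AbbesUllmo1996, Thm. A] [cite: PollackRubin2004, Thm. 7.3 (p > 2 in print; NOT used)] -/
theorem signedMainConjectureCMTwoRankZero_of_katoUpTo_of_mu
    (hBF : bsdTriple_of_hasCM_of_L_one_ne_zero) (hLrat : hasEntireLFunction_rat)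
    (hGZK : rank_eq_analyticRank_of_analyticRank_le_one)
    (h2 : realPeriodRat_eq_unit_mul_plusPeriod_two)
    (hT2 : ∀ (A : WeierstrassCurve ℚ) [A.IsElliptic] [A.IsGloballyMinimal],
      A.HasCM → A.analyticRank = 0 → GoodSS A 2 → A.frobeniusTrace 2 = 0 →
      ∀ (κ : ZpExtension ℚ 2) (γ : Field.absoluteGaloisGroup ℚ), κ.IsCyclotomic → κ.IsTopGenerator γ →
      ∀ D : SignedSelmerDualData A κ γ 1, Module.IsTorsion (IwasawaAlgebra 2) D.X)
    (hmu : ∀ (A : WeierstrassCurve ℚ) [A.IsElliptic] [A.IsGloballyMinimal],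
      A.HasCM → A.analyticRank = 0 → GoodSS A 2 → A.frobeniusTrace 2 = 0 →
      ∀ (κ : ZpExtension ℚ 2) (γ : Field.absoluteGaloisGroup ℚ), κ.IsCyclotomic → κ.IsTopGenerator γ →
      ∀ D : SignedSelmerDualData A κ γ 1, D.mu = 0)
    (hKim : ∀ (A : WeierstrassCurve ℚ) [A.IsElliptic] [A.IsGloballyMinimal],
      A.HasCM → A.analyticRank = 0 → GoodSS A 2 → A.frobeniusTrace 2 = 0 →
      ∀ (κ : ZpExtension ℚ 2) (γ : Field.absoluteGaloisGroup ℚ), κ.IsCyclotomic → κ.IsTopGenerator γ →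
      ∀ (D : SignedSelmerDualData A κ γ 1) [Module.Finite (IwasawaAlgebra 2) D.X],
        Module.IsTorsion (IwasawaAlgebra 2) D.X →
      ∀ g : IwasawaAlgebra 2, D.charIdeal = Ideal.span {g} → Finite (A.selmerGroupPInfty 2) →
        ∃ u : ℤ_[2]ˣ, ((PowerSeries.constantCoeff g : ℤ_[2]) : ℚ_[2]) =
          ((u : ℤ_[2]) : ℚ_[2]) * ((2 : ℕ) : ℚ_[2]) ^ (padicValNat 2 A.tamagawaProduct) *
            (Nat.card (A.selmerGroupPInfty 2) : ℚ_[2]))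
    (hup : ∀ (A : WeierstrassCurve ℚ) [A.IsElliptic] [A.IsGloballyMinimal],
      A.HasCM → A.analyticRank = 0 → GoodSS A 2 → A.frobeniusTrace 2 = 0 →
      ∀ (κ : ZpExtension ℚ 2) (γ : Field.absoluteGaloisGroup ℚ),
        κ.IsCyclotomic → κ.IsTopGenerator γ → IsCyclotomicVariable 2 γ →
      ∀ [NeZero (A.conductorNorm ℤ)] (f : CuspForm (Gamma0 (A.conductorNorm ℤ)) 2),
        IsNewformOf A f → ∀ (ϖ : ℚ), (ϖ : ℝ) * A.realPeriodRat = plusPeriod f →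
      ∀ (Lplus Lminus : IwasawaAlgebra 2), IsPollackPair f 2 Lplus Lminus →
      ∀ (D : SignedSelmerDualData A κ γ 1),
        ∃ (g h : IwasawaAlgebra 2) (m : ℕ), D.charIdeal = Ideal.span {g} ∧
          iwasawaToPowerSeries 2 (g * h) =
            PowerSeries.C ((2 : ℚ_[2]) ^ m * (ϖ : ℚ_[2])) * iwasawaToPowerSeries 2 (kobayashiL 1 Lplus Lminus)) :
    Summit.BirchSwinnertonDyer.BirchSwinnertonDyer.Theses.ThetaPartnerAtTwo.SignedMainConjectureCMTwoRankZero := by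
  intro A _ _ hcm hr hss ha
  have hL : A.entireLFunction 1 ≠ 0 := (A.analyticRank_eq_zero_iff_holds (hLrat A)).mp hr
  have hBSD : BSDp A 2 :=
    forall_bsdp_of_bsdTriple A A.tamagawaProduct_pos_holds (hBF A hcm hL) 2 Nat.prime_two
  refine ⟨fun κ γ hκ hγ D => ⟨hT2 A hcm hr hss ha κ γ hκ hγ D, hmu A hcm hr hss ha κ γ hκ hγ D⟩, ?_⟩
  intro κ γ hκ hγ hγ' _ f hf ϖ hϖ Lplus Lminus hPP D
  haveI := Kobayashi2003.SignedSelmerDualData.moduleFinite hγ D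
  have hTors := hT2 A hcm hr hss ha κ γ hκ hγ D
  obtain ⟨g, h, m, hchar, hdiv⟩ := hup A hcm hr hss ha κ γ hκ hγ hγ' f hf ϖ hϖ Lplus Lminus hPP D
  have hϖv : padicValRat 2 ϖ = 0 := padicValRat_periodRatio_eq_zero_two A h2 hss hf hϖ
  exact ⟨hTors, kobayashiMainConjecture_two_one_conclusion_of_upperDivisibilityUpTo_of_mu_eq_zero A hGZK hss ha
    hL hBSD (hKim A hcm hr hss ha) hκ hγ D hTors (hmu A hcm hr hss ha κ γ hκ hγ D) hf hϖ hϖv hPP hchar hdiv⟩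

end ThetaPartnerXRoute

end Summit.BirchSwinnertonDyer.BirchSwinnertonDyer.Theorems

end
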